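import Mathlib
import Literature.Analysis.FluidPDE.ClassicalSolution
import Literature.Analysis.FluidPDE.VectorCalculus
import Literature.Analysis.FluidPDE.SpaceTimeCalculus
import HarnessLib

/-!
# Analytic velocity and classical pressure give an analytic isobaric defect — crux
# stmt-NavierStokesRegularity-11739 (`IsobarTomography.TubeAlternative`), line
# `analytic-propagation-local-patch`, stub `stub_defectAnalyticOfVelocity`

If the velocity `w : ℝ → ℝ³ → ℝ³` has `uncurry w` jointly real-analytic on the open slab
`(-∞,0) × ℝ³` and `(w, q)` is a classical Navier–Stokes solution there (`ν = 1`, no force),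
then the isobaric defect `(t, x) ↦ ⟪curl w(t) x, ∇q(t) x⟫` is jointly real-analytic on the slab.

Proof. The pressure `q` itself need not be analytic (it is determined up to `+ c(t)`), but its
gradient is: by the momentum equation on the OPEN time set `(-∞,0)` (where the one-sided time
derivative `timeDerivWithin (Iio 0)` is the two-sided one),
`∇q(t) x = Δ w(t) x − ∂ₜ w(t, x) − (w·∇)w (t, x)`,
and each term is a continuous-(bi)linear evaluation of the joint derivatives
`D(uncurry w)`, `D²(uncurry w)` of the analytic `uncurry w` (chain rule through the affine
slices `x ↦ (t, x)`, `s ↦ (s, x)`; Mathlib `AnalyticAt.fderiv`,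
`ContinuousLinearMap.analyticAt_bilinear`, `AnalyticAt.comp₂`), hence jointly analytic; so is
`curl w(t) x = curlCLM (D(w t) x)`, and the inner product of two analytic maps is analytic.
The small "analytic space–time toolkit" below mirrors the tree's smooth one
(`IsSmoothSpaceTimeOn.fderiv_slice`, `.convect`, `.laplacian`, `SpaceTimeCalculus`).
-/

-- the problem directory repeats the summit name (`NavierStokesRegularity/NavierStokesRegularity`,
-- D-0017), which core's `dupNamespace` linter reports on every declaration of this namespace
set_option linter.dupNamespace false

noncomputable section

namespace Summit.NavierStokesRegularity.NavierStokesRegularity.Theorems.TubeAlternative.AnalyticPropagation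

open Set Filter Topology Function
open Literature.Analysis.FluidPDE
open scoped RealInnerProductSpace Laplacian ContDiff

/-- Physical space `ℝ³` (file-local notation; the registered stub signature is stated with it). -/
local notation "E3" => EuclideanSpace ℝ (Fin 3)

/-! ### Pointwise analytic algebra: evaluation, pre-composition, inner product -/

section Pointwise

variable {Y : Type*} [NormedAddCommGroup Y] [NormedSpace ℝ Y]
variable {X : Type*} [NormedAddCommGroup X] [NormedSpace ℝ X]
variable {F : Type*} [NormedAddCommGroup F] [NormedSpace ℝ F]
variable {G : Type*} [NormedAddCommGroup G] [NormedSpace ℝ G]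

/-- Evaluating an analytic operator-valued map at an analytic vector-valued map is analytic
(evaluation is a continuous bilinear map). -/
theorem analyticAt_clm_apply_of_analyticAt {L : Y → F →L[ℝ] G} {v : Y → F} {y : Y}
    (hL : AnalyticAt ℝ L y) (hv : AnalyticAt ℝ v y) : AnalyticAt ℝ (fun z => L z (v z)) y :=
  ((ContinuousLinearMap.id ℝ (F →L[ℝ] G)).analyticAt_bilinear (L y, v y)).comp₂ hL hv

/-- Pre-composing an analytic operator-valued map with a fixed continuous linear map is analytic
(composition is a continuous bilinear map). -/
theorem analyticAt_clm_comp_const_of_analyticAt {M : Y → F →L[ℝ] G} (K : X →L[ℝ] F) {y : Y}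
    (hM : AnalyticAt ℝ M y) : AnalyticAt ℝ (fun z => (M z).comp K) y := by
  have h := ((ContinuousLinearMap.compL ℝ X F G).analyticAt_bilinear (M y, K)).comp₂ hM
    analyticAt_const
  simpa only [ContinuousLinearMap.compL_apply] using h

/-- The inner product of two analytic maps into a real inner product space is analytic
(the inner product `innerSL ℝ` is a continuous bilinear map). -/
theorem analyticAt_inner_of_analyticAt {V : Type*} [NormedAddCommGroup V] [InnerProductSpace ℝ V]
    {a b : Y → V} {y : Y} (ha : AnalyticAt ℝ a y) (hb : AnalyticAt ℝ b y) :
    AnalyticAt ℝ (fun z => ⟪a z, b z⟫) y := by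
  have h := ((innerSL ℝ (E := V)).analyticAt_bilinear (a y, b y)).comp₂ ha hb
  exact h

end Pointwise

/-! ### Analytic space–time toolkit on an open time set -/

section SpaceTime

variable {X : Type*} [NormedAddCommGroup X] [NormedSpace ℝ X]
variable {F : Type*} [NormedAddCommGroup F] [NormedSpace ℝ F]
variable {S : Set ℝ} {w : ℝ → X → F}

/-- Slices `w t`, `t ∈ S`, of a jointly analytic field are analytic (composition with the affine
embedding `y ↦ (t, y)`). -/
theorem analyticAt_slice_of_analyticOnNhd_uncurry
    (hw : AnalyticOnNhd ℝ (uncurry w) (S ×ˢ univ)) {t : ℝ} (ht : t ∈ S) (x : X) :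
    AnalyticAt ℝ (w t) x :=
  (hw (t, x) ⟨ht, mem_univ x⟩).comp (analyticAt_const.prod analyticAt_id)

/-- Slices of a jointly analytic field are `C^n` for every `n`. -/
theorem contDiff_slice_of_analyticOnNhd_uncurry
    (hw : AnalyticOnNhd ℝ (uncurry w) (S ×ˢ univ)) {t : ℝ} (ht : t ∈ S) {n : WithTop ℕ∞} :
    ContDiff ℝ n (w t) :=
  AnalyticOnNhd.contDiff fun x _ => analyticAt_slice_of_analyticOnNhd_uncurry hw ht x

/-- On an open time set, the slice derivatives `(t, x) ↦ D(w t)(x)` of a jointly analytic field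
form a jointly analytic (operator-valued) field: on `S × X` they equal
`D(uncurry w)(t, x) ∘ (0, ·)`, and the derivative of an analytic map is analytic. -/
theorem analyticOnNhd_uncurry_fderiv_slice [CompleteSpace F]
    (hw : AnalyticOnNhd ℝ (uncurry w) (S ×ˢ univ)) (hS : IsOpen S) :
    AnalyticOnNhd ℝ (uncurry fun t x => fderiv ℝ (w t) x) (S ×ˢ univ) := by
  have hc : AnalyticOnNhd ℝ
      (fun z => (fderiv ℝ (uncurry w) z).comp (ContinuousLinearMap.inr ℝ ℝ X)) (S ×ˢ univ) :=
    fun z hz => analyticAt_clm_comp_const_of_analyticAt _ (hw.fderiv z hz)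
  refine hc.congr (hS.prod isOpen_univ) ?_
  rintro ⟨t, x⟩ ⟨ht, -⟩
  exact ((hasFDerivAt_slice (hw _ ⟨ht, mem_univ x⟩).differentiableAt.hasFDerivAt).fderiv).symm

/-- On an open time set, `(t, x) ↦ D(w t)(x) [v(t, x)]` is jointly analytic for jointly analytic
`w` and `v`. -/
theorem analyticOnNhd_uncurry_fderiv_slice_apply [CompleteSpace F]
    (hw : AnalyticOnNhd ℝ (uncurry w) (S ×ˢ univ)) (hS : IsOpen S) {v : ℝ → X → X}
    (hv : AnalyticOnNhd ℝ (uncurry v) (S ×ˢ univ)) :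
    AnalyticOnNhd ℝ (uncurry fun t x => fderiv ℝ (w t) x (v t x)) (S ×ˢ univ) := by
  intro z hz
  have h := analyticAt_clm_apply_of_analyticAt (analyticOnNhd_uncurry_fderiv_slice hw hS z hz)
    (hv z hz)
  exact h

/-- On an open time set, the one-sided time derivative `timeDerivWithin S w` of a jointly
analytic field is jointly analytic: it is the two-sided derivative `D(uncurry w)(t, x) (1, 0)`. -/
theorem analyticOnNhd_uncurry_timeDerivWithin [CompleteSpace F]
    (hw : AnalyticOnNhd ℝ (uncurry w) (S ×ˢ univ)) (hS : IsOpen S) :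
    AnalyticOnNhd ℝ (uncurry fun t x => timeDerivWithin S w t x) (S ×ˢ univ) := by
  have hc : AnalyticOnNhd ℝ (fun z => fderiv ℝ (uncurry w) z (1, 0)) (S ×ˢ univ) :=
    fun z hz => analyticAt_clm_apply_of_analyticAt (hw.fderiv z hz) analyticAt_const
  refine hc.congr (hS.prod isOpen_univ) ?_
  rintro ⟨t, x⟩ ⟨ht, -⟩
  change fderiv ℝ (uncurry w) (t, x) (1, 0) = timeDerivWithin S w t x
  rw [timeDerivWithin_eq_deriv hS ht w x]
  exact ((hasDerivAt_timeLine (hw _ ⟨ht, mem_univ x⟩).differentiableAt.hasFDerivAt).deriv).symm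

/-- The inner product of two jointly analytic fields is jointly analytic. -/
theorem analyticOnNhd_uncurry_inner {V : Type*} [NormedAddCommGroup V] [InnerProductSpace ℝ V]
    {U : Set (ℝ × X)} {a b : ℝ → X → V} (ha : AnalyticOnNhd ℝ (uncurry a) U)
    (hb : AnalyticOnNhd ℝ (uncurry b) U) :
    AnalyticOnNhd ℝ (uncurry fun t x => ⟪a t x, b t x⟫) U := by
  intro z hz
  have h := analyticAt_inner_of_analyticAt (ha z hz) (hb z hz)
  exact h

end SpaceTime

section SpaceTimeInner

variable {E : Type*} [NormedAddCommGroup E] [InnerProductSpace ℝ E] [FiniteDimensional ℝ E]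
variable {F : Type*} [NormedAddCommGroup F] [InnerProductSpace ℝ F]
variable {S : Set ℝ}

omit [FiniteDimensional ℝ E] in
/-- On an open time set, the convective derivative `(u·∇)v` of jointly analytic fields is jointly
analytic. -/
theorem analyticOnNhd_uncurry_convect [CompleteSpace F] {u : ℝ → E → E} {v : ℝ → E → F}
    (hu : AnalyticOnNhd ℝ (uncurry u) (S ×ˢ univ)) (hv : AnalyticOnNhd ℝ (uncurry v) (S ×ˢ univ))
    (hS : IsOpen S) : AnalyticOnNhd ℝ (uncurry fun t x => convect (u t) (v t) x) (S ×ˢ univ) :=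
  analyticOnNhd_uncurry_fderiv_slice_apply hv hS hu

/-- On an open time set, the slice Laplacian `Δ(v t)(x)` of a jointly analytic field is jointly
analytic: `Δ = Σᵢ ∂ᵢ∂ᵢ` over an orthonormal basis (tree `laplacian_eq_sum_fderiv_fderiv`) and
each `∂ᵢ` preserves joint analyticity. -/
theorem analyticOnNhd_uncurry_laplacian [CompleteSpace F] {v : ℝ → E → F}
    (hv : AnalyticOnNhd ℝ (uncurry v) (S ×ˢ univ)) (hS : IsOpen S) :
    AnalyticOnNhd ℝ (uncurry fun t x => (Δ (v t)) x) (S ×ˢ univ) := by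
  set b := stdOrthonormalBasis ℝ E
  have h1 : ∀ i, AnalyticOnNhd ℝ (uncurry fun t x => fderiv ℝ (v t) x (b i)) (S ×ˢ univ) :=
    fun i => analyticOnNhd_uncurry_fderiv_slice_apply hv hS (v := fun _ _ => b i)
      analyticOnNhd_const
  have h2 : ∀ i, AnalyticOnNhd ℝ
      (uncurry fun t x => fderiv ℝ (fun y => fderiv ℝ (v t) y (b i)) x (b i)) (S ×ˢ univ) :=
    fun i => analyticOnNhd_uncurry_fderiv_slice_apply (h1 i) hS (v := fun _ _ => b i)
      analyticOnNhd_const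
  have h3 : AnalyticOnNhd ℝ
      (fun z => ∑ i, (uncurry fun t x => fderiv ℝ (fun y => fderiv ℝ (v t) y (b i)) x (b i)) z)
      (S ×ˢ univ) :=
    Finset.analyticOnNhd_fun_sum Finset.univ fun i _ => h2 i
  refine h3.congr (hS.prod isOpen_univ) ?_
  rintro ⟨t, x⟩ ⟨ht, -⟩
  exact (laplacian_eq_sum_fderiv_fderiv b
    (contDiff_slice_of_analyticOnNhd_uncurry hv ht (n := 2)) x).symm

end SpaceTimeInner

/-- On an open time set, the vorticity `(t, x) ↦ curl (w t) x` of a jointly analytic field on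
`S × ℝ³` is jointly analytic (`curl = curlCLM ∘ D`). -/
theorem analyticOnNhd_uncurry_curl {S : Set ℝ} {w : ℝ → E3 → E3}
    (hw : AnalyticOnNhd ℝ (uncurry w) (S ×ˢ univ)) (hS : IsOpen S) :
    AnalyticOnNhd ℝ (uncurry fun t x => curl (w t) x) (S ×ˢ univ) := by
  have heq : (uncurry fun t x => curl (w t) x) =
      (curlCLM : (E3 →L[ℝ] E3) →L[ℝ] E3) ∘ (uncurry fun t x => fderiv ℝ (w t) x) := by
    funext z
    rfl
  rw [heq]
  exact curlCLM.comp_analyticOnNhd (analyticOnNhd_uncurry_fderiv_slice hw hS)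

/-- **Stub `stub_defectAnalyticOfVelocity` (line `analytic-propagation-local-patch` of crux
`IsobarTomography.TubeAlternative`).** If the velocity `w` is jointly real-analytic on the open
slab `(-∞,0) × ℝ³` and `(w, q)` is a classical Navier–Stokes solution there (`ν = 1`, no force),
then the isobaric defect `(t, x) ↦ ⟪curl w(t) x, ∇q(t) x⟫` is jointly real-analytic on the slab:
by the momentum equation `∇q = Δw − ∂ₜw − (w·∇)w` on the open time set `(-∞,0)` (where the
one-sided time derivative is the two-sided one), and derivatives, continuous-bilinear evaluations
and inner products of analytic maps are analytic. -/
theorem stub_defectAnalyticOfVelocity :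
    ∀ (w : ℝ → E3 → E3) (q : ℝ → E3 → ℝ),
    AnalyticOnNhd ℝ (uncurry w) (Set.Iio 0 ×ˢ Set.univ) →
    IsClassicalNSSolutionOn (Set.Iio 0) 1 0 w q →
    AnalyticOnNhd ℝ (fun z : ℝ × E3 => ⟪curl (w z.1) z.2, gradient (q z.1) z.2⟫)
      (Set.Iio 0 ×ˢ Set.univ) := by
  intro w q hA hcl
  have hS : IsOpen (Iio (0 : ℝ)) := isOpen_Iio
  -- the analytic pieces of `∇q = Δw − ∂ₜw − (w·∇)w` and the vorticity
  have hcurl := analyticOnNhd_uncurry_curl hA hS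
  have hlap := analyticOnNhd_uncurry_laplacian hA hS
  have htime := analyticOnNhd_uncurry_timeDerivWithin hA hS
  have hconv := analyticOnNhd_uncurry_convect hA hA hS
  have hrhs : AnalyticOnNhd ℝ (uncurry fun t x =>
      (Δ (w t)) x - timeDerivWithin (Iio 0) w t x - convect (w t) (w t) x) (Iio 0 ×ˢ univ) :=
    (hlap.sub htime).sub hconv
  have hF : AnalyticOnNhd ℝ (uncurry fun t x =>
      ⟪curl (w t) x, (Δ (w t)) x - timeDerivWithin (Iio 0) w t x - convect (w t) (w t) x⟫)
      (Iio 0 ×ˢ univ) :=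
    analyticOnNhd_uncurry_inner hcurl hrhs
  refine hF.congr (hS.prod isOpen_univ) ?_
  rintro ⟨t, x⟩ ⟨ht, -⟩
  -- momentum with `ν = 1`, `f = 0`: `∂ₜw + (w·∇)w + ∇q = Δ w` at `(t, x)`
  have hm := hcl.momentum t ht x
  simp only [one_smul, Pi.zero_apply, add_zero] at hm
  rw [eq_sub_iff_add_eq] at hm
  simp only [Function.uncurry_apply_pair]
  congr 1
  rw [← hm]
  abel

end Summit.NavierStokesRegularity.NavierStokesRegularity.Theorems.TubeAlternative.AnalyticPropagation

end
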